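import Summits.BirchSwinnertonDyer.BirchSwinnertonDyer.Theorems.PrintX8SmallImageRiderRankZero
import Summits.BirchSwinnertonDyer.BirchSwinnertonDyer.Theorems.PrintX8VSCMuBoundSmallImageContra
import Summits.BirchSwinnertonDyer.BirchSwinnertonDyer.Theorems.PrintX8VSOneColourMuAnX8
import Summits.BirchSwinnertonDyer.BirchSwinnertonDyer.Theorems.PrintX8SharpFlatRankZeroRoadContra
import HarnessLib

/-!
# Corner X8 (`p = 3` good supersingular, `a₃ = ±3`), analytic rank `0`, ANY `3`-adic image: the UPPER half
# `ord₃ #Ш ≤ ord₃ #Ш_an` in PRINT KEYING — Kato's divisibility through Sprung's ♯/♭ Coleman maps for the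
# CONTRAGREDIENT dual `X^•(E/ℚ_∞) = X^•(γ⁻¹)` (Sprung 2012 Thm. 7.16 as printed, `thm716_…_contra`), made INTEGRAL on
# all of X8 by THEOREM B (one colour of unit content, input-free) + the contragredient `μ`-transfer; unit cells close
# (cell `bsd-print-x8`, D-0131 (2) print tier, prover seat p2 gen 4; twin route `PrintX8VSC`; `--supports` the
# print-keyed main-conjecture node `SharpFlatMainConjectureX8Contra`, closes nothing)

PARTITION (leaf `ClassX8` = K3 row A8 = W-ALL row 8; 217 census cells, 142 of analytic rank `0`, of which 60 with image
`C_ns⁺(3)`): per-pair and class theorems CONDITIONAL on PUBLISHED named facts only (no rider, no image datum, no K1, no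
K′/C′); closes NONE; 0 census cells move by class theorem; BSD is not proved by any of this.

## Why this file (seat p2's sentence, clauses 1–2, REPAIRED to the print key and made image-free)

Seat p2: «♯♭ ⊇-half from Kato via Sprung's ♯♭ Coleman maps + ♯♭ control ⇒ r0 upper bound; unit cells close outright».
The tree holds that chain twice in the `γ`-KEY — `X8SharpFlatKatoUpperHalf` (p2 g0, X8 ∩ surj(3), binder
`thm716_sharpFlatCharIdeal_divisibility`) and `PrintX8SmallImageRiderRankZero` (p3 g2, X8 ∩ ¬surj(3), binders `thm716_…` +
`thm714seq_sharpFlatColemanKato_zeta` + a one-colour RIDER). Since then (2026-08-28): (i) the cell's referee / vet /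
INPUTS desk decided the KEYING (R-250, lit T67/T69): Sprung's `X^•(E/ℚ_∞)` of Def. 7.11 / Thm. 7.16 is the `γ⁻¹`-keyed
(contragredient) datum, the `γ`-keyed `thm716_…` reads in nature as «`pⁿ·ι(L^•) ∈ Char X^•`» and the `γ`-keyed input
layer is kernel-inconsistent on coprime cells (LEAD g6 `ChromaticKeying.false_of_typedInputsX8_of_coprimeCell_flatZero`,
p666272/p666883) — whence the repair twin `PrintX8VSC` over `thm716_sharpFlatCharIdeal_divisibility_contra` (p662311) and
`thm714seq_sharpFlatColemanKato_zeta[_Joint]_contra`; (ii) THEOREM B landed input-free (p1 g5 `PrintX8VSOneColourMuAnX8.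
ClassX8.oneColourMuAn`: on EVERY X8 pair one colour `•₀` has `L^{•₀} ≠ 0`, unit content, `μ(Λ/(L^{•₀})) = 0`), so the
rider is discharged; (iii) w2 g11 ported the `μ`-transfer to the print key (`X8MainConjectureContra.
X8.sharpFlatMu_le_of_oneColour_hasUnitContent_contra`, p675769). THIS FILE composes (i)–(iii) with the key-free links of
the two `γ`-files into the r0 UPPER HALF ON ALL OF X8 IN PRINT KEYING, with NO image hypothesis and NO rider:

* §1 `sharpFlatUpper_dvd_of_muInvariant_eq_zero_contra` — Λ-algebra, print key: `char X^•(γ⁻¹) = (ξ)`, `μ = 0`, Thm. 7.16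
  RATIONAL clause (`thm716_…_contra.exists_dvd_pow_mul`) ⟹ `ξ ∣ L^•` (Gauss' lemma for `3 ∈ Λ`).
* §2 `X8.sharpFlatUpper_dvd_contra_of_hasUnitContent` — PER PAIR, ANY image: for a colour `•` of unit content and EVERY
  `γ⁻¹`-keyed dual datum `D` of `Sel^•(E/ℚ_∞)`, `char D.X = (ξ) ⟹ ξ ∣ L^•` INTEGRALLY: big image by Thm. 7.16's `n = 0`
  clause (`3`-adic surjectivity from `surj(3)`, Wuthrich 2014 Lemma 20, kernel theorem); small image by `μ(D.X) ≤
  μ(Λ/(L^•)) = 0` (the contragredient `μ`-transfer, binder `hCKc`) and §1. This is the Kato (⊇) HALF of Sprung's Main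
  Conjecture 7.21 for `•` in the printed currency of `PrintX8VSC.SharpFlatMainConjectureX8Contra` — the half that needs
  neither K′ (`KatoFineLowerSporadicGivenHeldX8Contra`) nor C′ (`CyclotomicLowerPosLevelGivenHeldX8Contra`).
* §3 `X8.missingUpperBoundAt_of_sharpFlatKatoContra_of_analyticRank_eq_zero` — **X8 ∧ `r_an = 0`, ANY image:
  `ord₃ #Ш ≤ ord₃ #Ш_an`** from the nine PUBLISHED named facts displayed (modularity `hmodf`/`hmod`, Sprung 2012 Thm. 2.2
  `h22`, Thm. 7.14 `h714`, Thm. 7.16 print key `h716c`, Def. 6.1/(3) package print key `hCKc`, Sprung 2024 §5.2 `h59`,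
  period unit `h3`, GZK `hGZK`; `h22` and `h59` are THEOREMS of the tree — `thm22_exists_isHondaSystem_holds`,
  `SharpFlatCount.lem59AllN_sharpFlatCharValue_rankZero_holds` — displayed only to keep this file outside the Theses
  cone): THEOREM B picks `•₀`; §2 gives `ξ ∣ L^{•₀}` for a print-keyed `D`; the Euler characteristic (K•) is obtained AT
  KEY `γ` on the real tree-keyed dual with generator `ι ξ` (`charIdeal_eq_span_invol_of_inv`, referee N-287b: the
  `γ`-universal fact `lem59AllN_…` is instantiated at key `γ` only) and moved to `ξ` by `(ι ξ)(0) = ξ(0)`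
  (`constantCoeff_invol`); p2 g0's key-free `missingUpperBoundAt_of_chromaticUpperDivisibility` concludes.
* §3 corollaries: `X8.bsdp_of_shaAn_le_of_sharpFlatKatoContra_…` (**UNIT CELLS, any image: `ord₃ #Ш_an ≤ 0 ⟹ BSD(E,3)`**
  — on the cell's census of OPEN cells (ty3 `x8_records.json`, 217 rows) 54 of the 142 rank-`0` cells have `3 ∤ #Ш_an`,
  all 54 with image `C_ns⁺(3)`; every one of the 82 surj rank-`0` census cells has `3 ∣ #Ш_an` (the surj unit cells are
  not on the census), so on the census the corollary reaches exactly the 54 cells of p3's rider road, now rider-free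
  [ERRATUM 2026-08-28T23:3xZ: the first filing p677031 said «134 of 142 (80 surj + 54)» — wrong, corrected here]);
  `X8.bsdp_of_missingLowerBoundAt_of_sharpFlatKatoContra_…`
  (the residual on an r0 pair is EXACTLY the lower half `MissingLowerBoundAt W 3` = K1 at the pair);
  `X8.upperHalf_rankZero_of_sharpFlatFactsContra` (CLASS form, all 142 r0 cells, image-free).

HONEST STATUS. Conditional on the displayed named facts (all PUBLISHED; seven of them E-specific print, two of them tree
theorems); THEOREM B enters as a kernel theorem. beyond-print theorem: YES (modest) — the INTEGRAL Kato-side bound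
`ord₃ #Ш ≤ ord₃ #Ш_an` at `a₃ = ±3` for NON-surjective `3`-adic image is not in print (Kato Thm. 12.5 (4) / Sprung 2012
Thm. 7.16 give `n = 0` only under surjectivity; Perrin-Riou 2003 Prop. 4.8 carries (12.5.2)); it is print + THEOREM B.
No K1, no K′/C′, no main conjecture is proved; the leaf X8 and BSD are NOT proved by any of this.

References: [Sprung2012] Def. 6.1 (p. 1495), Thm. 2.2, Prop. 6.14, Def. 7.11, Thm. 7.14 with (3), Thm. 7.16, Prop. 7.19,
§7.5 l.1 (pp. 1487–1505); [Sprung2024] §5.2 Lemmas 5.5–5.9, Proof of Thm. 5.3 (pp. 39–41); [Sprung2017] Thm. 1.12, Cor.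
4.10/4.11; [Kato2004Asterisque] Thm. 12.5 (12.5.2), Thm. 12.6 (p. 222), §13.8, §17.13; [Wuthrich2014] Lemma 20 (p. 399);
[GreenbergVatsal2000] p. 2 (1)–(2), §3 Rem. 3.4; [GreenbergLNM1716] §1 (p. 60); [MazurTateTeitelbaum1986Invent] Ch. I §17;
[Washington1997] §7.1, §13.2; [Pollack2003] Def. 6.15; [Miller2011LMS] Def. 1.1; tree: p2 g0 `X8SharpFlatKatoUpperHalf`
(p540191), p3 g2 `PrintX8SmallImageRiderRankZero`, p1 g5 `PrintX8VSOneColourMuAnX8` (p600192), w2 g11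
`PrintX8VSCMuBoundSmallImageContra` (p675769), w3 g10 `PrintX8SharpFlatRankZeroRoadContra` (p674964), contra-ty
`Sprung2012/SharpFlatColemanKatoContragredient` (p662311).
-/

set_option autoImplicit false
-- justification: the mandated namespace `Summit.BirchSwinnertonDyer.BirchSwinnertonDyer.Theorems`
-- (single-conjunct summit, Sub = Summit) repeats a segment by design (D-0017).
set_option linter.dupNamespace false

noncomputable section

open scoped Classical NumberField MatrixGroups ModularForm

open NumberField IsDedekindDomain WeierstrassCurve CongruenceSubgroup Field
  Literature.NumberTheory.EllipticCurves Literature.NumberTheory.EllipticCurves.ModularForms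
  Literature.NumberTheory.EllipticCurves.Rank1Residual
  Literature.NumberTheory.EllipticCurves.Rank1Residual.Typed
  Literature.NumberTheory.EllipticCurves.Sprung2017 Literature.NumberTheory.EllipticCurves.Sprung2012
  Literature.NumberTheory.EllipticCurves.Sprung2024
  Literature.NumberTheory.EllipticCurves.GreenbergVatsal2000
  Literature.NumberTheory.EllipticCurves.ZpExtension
  Literature.NumberTheory.EllipticCurves.IwasawaAlgebra
  Summit.BirchSwinnertonDyer.BirchSwinnertonDyer.Theorems
  Summit.BirchSwinnertonDyer.Rank1Residual.Supersingular
  Summit.BirchSwinnertonDyer.Rank1Residual.X1.MuLambda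

namespace Summit.BirchSwinnertonDyer.BirchSwinnertonDyer.Theorems.X8KatoUpperHalfContra

/-! ### §1 Λ-algebra, print keying: Sprung's RATIONAL Kato divisibility is INTEGRAL when `μ(X^•(γ⁻¹)) = 0` -/

section Upper

variable {W : WeierstrassCurve ℚ} [W.IsElliptic] [W.IsGloballyMinimal] {p : ℕ} [Fact p.Prime]
  {N : ℕ} [NeZero N] {f : CuspForm (Gamma0 N) 2}
  {κ : ZpExtension ℚ p} {γ : absoluteGaloisGroup ℚ} {v : HeightOneSpectrum (𝓞 ℚ)}
  {g : absoluteGaloisGroup (v.adicCompletion ℚ)}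
  {cneg : localPoints W (v.adicCompletion ℚ)} {c : ℕ → localPoints W (v.adicCompletion ℚ)}
  {col : Chroma} {Lsharp Lflat : IwasawaAlgebra p}

/-- **`μ(X^•(γ⁻¹)) = 0` makes Sprung 2012 Thm. 7.16 (PRINT keying) integral, with NO hypothesis on the Galois image.**
In the cyclotomic / Honda setting of Thm. 7.16, for a colour `•` with `L^• ≠ 0`, a CONTRAGREDIENT dual datum `D` (key
`γ⁻¹`) of `Sel^•(E/ℚ_∞)` (f.g. torsion), a characteristic power series `ξ` (`char X^• = (ξ)`) and `μ(D.X) = 0`: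
**`ξ ∣ L^•_p(E)` in `Λ`.** Proof: `μ = 0 ⟺ ξ` has unit content (Greenberg–Vatsal (2),
`muInvariant_eq_zero_iff_hasUnitContent`); Thm. 7.16's RATIONAL clause `ξ ∣ pⁿ·L^•` (`thm716_…_contra.exists_dvd_pow_mul`);
Gauss' lemma for the prime `p ∈ Λ` (`Additive.dvd_of_dvd_C_pow_mul_of_hasUnitContent`). Print-key twin of
`PrintX8SmallImageRiderRankZero.sharpFlatUpper_dvd_of_muInvariant_eq_zero`. [cite: Sprung2012, Thm. 7.16 (p. 1504) and Def. 7.11 (p. 1503)]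
[cite: GreenbergVatsal2000, p. 2, (1)–(2)] [cite: Washington1997, §7.1 and §13.2] -/
theorem sharpFlatUpper_dvd_of_muInvariant_eq_zero_contra (h716c : thm716_sharpFlatCharIdeal_divisibility_contra)
    (hp : p ≠ 2) (hgood : W.HasGoodReductionAtPrime p) (hap : (p : ℤ) ∣ W.frobeniusTrace p)
    (hf : IsNewformOf W f) (hκ : κ.IsCyclotomic) (hγ : κ.IsTopGenerator γ)
    (hγ' : IsCyclotomicVariable p γ) (hv : (p : 𝓞 ℚ) ∈ v.asIdeal)
    (hg : κ.IsTopGenerator (resGalOfEmb (closureEmb (K := ℚ) (v.adicCompletion ℚ)) g))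
    (hH : IsHondaSystem κ (closureEmb (K := ℚ) (v.adicCompletion ℚ)) W (W.frobeniusTrace p) g cneg c)
    (hSP : IsSprungPair f p (W.frobeniusTrace p) Lsharp Lflat) (hL0 : chromaticL col Lsharp Lflat ≠ 0)
    (D : SharpFlatSelmerDualData W κ γ⁻¹ (closureEmb (K := ℚ) (v.adicCompletion ℚ))
      (W.frobeniusTrace p) g c col) [Module.Finite (IwasawaAlgebra p) D.X]
    (hX : Module.IsTorsion (IwasawaAlgebra p) D.X)
    {ξ : IwasawaAlgebra p} (hξ : D.charIdeal = Ideal.span {ξ}) (hμ : muInvariant p D.X = 0) :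
    ξ ∣ chromaticL col Lsharp Lflat := by
  have hu : HasUnitContent ξ := (muInvariant_eq_zero_iff_hasUnitContent D.X hX hξ).mp hμ
  obtain ⟨n, hn⟩ := h716c.exists_dvd_pow_mul hp hgood hap hf hκ hγ hγ' hv hg hH hSP hL0 D hX hξ
  have hC : ((p : IwasawaAlgebra p) ^ n : IwasawaAlgebra p) = PowerSeries.C ((p : ℤ_[p]) ^ n) := by
    rw [map_pow, map_natCast]
  rw [hC] at hn
  exact Summit.BirchSwinnertonDyer.Rank1Residual.Additive.dvd_of_dvd_C_pow_mul_of_hasUnitContent hu n hn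

end Upper

/-! ### §2 PER PAIR, ANY image, print keying: a colour of UNIT CONTENT has the INTEGRAL Kato half `ξ ∣ L^•` -/

section KatoHalf

variable (W : WeierstrassCurve ℚ) [W.IsElliptic] [W.IsGloballyMinimal] (p : ℕ) [Fact p.Prime]

/-- **X8, ANY `3`-adic image, PRINT keying: for a colour `•` of UNIT CONTENT, Kato's divisibility `ξ ∣ L^•` is INTEGRAL
for EVERY contragredient dual datum `D` of `Sel^•(E/ℚ_∞)`** (`char D.X = (ξ)`). X8 pair `(W, 3)`, cyclotomic `(κ, γ)`
with `γ ↦ 1 + X`, the place `v ∋ 3` with local lift `g`, a Honda system `(cneg, c)`, the newform `f` of `W`, a Sprung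
pair `(L♯, L♭)`, and `•` with `HasUnitContent (L^•)`. Named inputs, BY NAME (published): Sprung 2012 Thm. 7.14 (`h714`,
keying-immune, instantiated AT KEY `γ` and transported by the proved `ι`-dictionary), Thm. 7.16 PRINT keying (`h716c`),
Def. 6.1 / Thm. 7.14 (3) / Kato 12.6 package PRINT keying (`hCKc`), the period unit at `3` (`h3`). Split on the image:
`surj(3)` ⟹ `3`-adic surjectivity (Wuthrich 2014 Lemma 20, kernel theorem `…_holds`) ⟹ Thm. 7.16's `n = 0` clause;
`¬ surj(3)` ⟹ `μ(D.X) ≤ μ(Λ/(L^•)) = 0` (w2's contragredient `μ`-transfer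
`X8.sharpFlatMu_le_of_oneColour_hasUnitContent_contra` fed with `•₀ = •`, and `μ(Λ/(L^•)) = 0` for unit content) ⟹ §1.
This is the (⊇) half of Sprung's Main Conj. 7.21 for `•` in the currency of `PrintX8VSC.SharpFlatMainConjectureX8Contra`;
the (⊆) half is K′ ∧ C′. PER PAIR; conditional on the four named facts; closes nothing.
[cite: Sprung2012, Def. 6.1 (p. 1495), Def. 7.11 (p. 1503), Thm. 7.14 with (3), Thm. 7.16 (p. 1504), Main Conj. 7.21 (p. 1505)]
[cite: Kato2004Asterisque, Thm. 12.5 (4) and (12.5.2), Thm. 12.6 (p. 222)] [cite: Wuthrich2014, Lemma 20 (p. 399)]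
[cite: GreenbergVatsal2000, p. 2 (1)–(2) and §3 Remark 3.4] -/
theorem X8.sharpFlatUpper_dvd_contra_of_hasUnitContent
    (h714 : thm714_sharpFlatSelmerDual_finite_torsion)
    (h716c : thm716_sharpFlatCharIdeal_divisibility_contra)
    (hCKc : thm714seq_sharpFlatColemanKato_zeta_contra) (h3 : realPeriodRat_eq_unit_mul_plusPeriod_three)
    (hX : ClassX8 W p)
    {κ : ZpExtension ℚ p} {γ : absoluteGaloisGroup ℚ} (hκ : κ.IsCyclotomic)
    (hγ : κ.IsTopGenerator γ) (hγ' : IsCyclotomicVariable p γ)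
    {v : HeightOneSpectrum (𝓞 ℚ)} (hv : (p : 𝓞 ℚ) ∈ v.asIdeal)
    {g : absoluteGaloisGroup (v.adicCompletion ℚ)}
    (hg : κ.IsTopGenerator (resGalOfEmb (closureEmb (K := ℚ) (v.adicCompletion ℚ)) g))
    {cneg : localPoints W (v.adicCompletion ℚ)} {c : ℕ → localPoints W (v.adicCompletion ℚ)}
    (hc : IsHondaSystem κ (closureEmb (K := ℚ) (v.adicCompletion ℚ)) W (W.frobeniusTrace p) g cneg c)
    {N : ℕ} [NeZero N] {f : CuspForm (Gamma0 N) 2} (hf : IsNewformOf W f)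
    {Lsharp Lflat : IwasawaAlgebra p} (hSP : IsSprungPair f p (W.frobeniusTrace p) Lsharp Lflat)
    (col : Chroma) (hu : HasUnitContent (chromaticL col Lsharp Lflat))
    (D : SharpFlatSelmerDualData W κ γ⁻¹ (closureEmb (K := ℚ) (v.adicCompletion ℚ))
      (W.frobeniusTrace p) g c col)
    {ξ : IwasawaAlgebra p} (hξ : D.charIdeal = Ideal.span {ξ}) : ξ ∣ chromaticL col Lsharp Lflat := by
  have hp3 : p = 3 := hX.1
  subst hp3
  have hp2 : (3 : ℕ) ≠ 2 := by decide
  have hgood : W.HasGoodReductionAtPrime 3 := hX.2.1.1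
  have hdvd : ((3 : ℕ) : ℤ) ∣ W.frobeniusTrace 3 := hX.2.1.2
  have hirr : W.HasIrreducibleModPGaloisRep 3 := ClassX8.irr W 3 hX
  have hcol : chromaticL col Lsharp Lflat ≠ 0 :=
    Summit.BirchSwinnertonDyer.Rank1Residual.X11a.ne_zero_of_hasUnitContent hu
  -- Thm. 7.14 AT KEY `γ` on the real tree-keyed dual, transported to the print-keyed `D` by the `ι`-dictionary
  let D₀ := sharpFlatSelmerDualData W κ (closureEmb (K := ℚ) (v.adicCompletion ℚ))
    (W.frobeniusTrace 3) g c col hγ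
  obtain ⟨hfin₀, htor₀⟩ :=
    h714 W 3 hp2 hgood hdvd f hf κ γ hκ hγ hγ' v hv g hg cneg c hc col Lsharp Lflat hSP hcol D₀
  haveI := hfin₀
  haveI : Module.Finite (IwasawaAlgebra 3) D.X := (sharpFlatSelmerDualData_finite_inv_iff D₀ D).1 hfin₀
  have htor : Module.IsTorsion (IwasawaAlgebra 3) D.X := (sharpFlatSelmerDualData_isTorsion_inv_iff D₀ D).1 htor₀
  by_cases hs : Surj W 3
  · -- big image: `3`-adic surjectivity (Wuthrich 2014 Lemma 20) and Thm. 7.16's `n = 0` clause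
    have hsurj : ∀ n : ℕ, W.HasSurjectiveModNGaloisRep (3 ^ n : ℕ) :=
      surjective_pow_of_surj_of_good W 3 Wuthrich2014.lemma20_surjective_threeAdic_of_semistable_holds
        hp2 hgood hs
    exact h716c.dvd_of_charIdeal_eq_span hp2 hgood hdvd hf hκ hγ hγ' hv hg hc hSP hcol D htor hsurj hξ
  · -- small image: a period ratio for `f`, then `μ(D.X) ≤ μ(Λ/(L^•)) = 0` by the contragredient `μ`-transfer
    obtain ⟨u, hu1, hΩ⟩ := h3 W hgood hirr f hf
    have hu0 : (u : ℝ) ≠ 0 := by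
      intro h
      have h0' : u = 0 := by exact_mod_cast h
      rw [h0'] at hu1
      simp at hu1
    have hϖ : ((u⁻¹ : ℚ) : ℝ) * W.realPeriodRat = plusPeriod f := by
      rw [hΩ, Rat.cast_inv, ← mul_assoc, inv_mul_cancel₀ hu0, one_mul]
    have hμL : muInvariant 3 (IwasawaAlgebra 3 ⧸ Ideal.span {chromaticL col Lsharp Lflat}) = 0 :=
      (PrintX8SharpFlatMuTransfer.muInvariant_quotient_span_eq_zero_iff_hasUnitContent hcol).mpr hu
    have hμ : muInvariant 3 D.X = 0 :=
      Nat.le_zero.mp ((X8MainConjectureContra.X8.sharpFlatMu_le_of_oneColour_hasUnitContent_contra W 3 hCKc h3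
        hX hs f hf u⁻¹ hϖ κ γ hκ hγ hγ' v hv g hg cneg c hc hSP col hu col hcol D).trans hμL.le)
    exact sharpFlatUpper_dvd_of_muInvariant_eq_zero_contra h716c hp2 hgood hdvd hf hκ hγ hγ' hv hg hc hSP hcol D
      htor hξ hμ

end KatoHalf

/-! ### §3 X8 ∧ `r_an = 0`, ANY image, print keying: the UPPER half `ord₃ #Ш ≤ ord₃ #Ш_an`; unit cells -/

section RankZero

variable (W : WeierstrassCurve ℚ) [W.IsElliptic] [W.IsGloballyMinimal] (p : ℕ) [Fact p.Prime]

/-- **X8 ∧ `r_an = 0`, ANY `3`-adic image, PRINT keying: `ord₃ #Ш ≤ ord₃ #Ш_an`** from Kato through Sprung's ♯/♭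
Coleman maps for the CONTRAGREDIENT dual + the ♯/♭ control, with THEOREM B in place of any rider or image hypothesis.
Named inputs (published, displayed): modularity `exists_isNewformOf` (`hmodf`) and entire continuation (`hmod`), Sprung
2012 Thm. 2.2 (`h22`; a tree theorem, `thm22_exists_isHondaSystem_holds`), Thm. 7.14 (`h714`), Thm. 7.16 PRINT keying
(`h716c`), the Def. 6.1 / (3) / Kato 12.6 package PRINT keying (`hCKc`), Sprung 2024 §5.2 Lemmas 5.5–5.9 all `N` (`h59`;
a tree theorem, `SharpFlatCount.lem59AllN_sharpFlatCharValue_rankZero_holds`), the period unit at `3` (`h3`), GZK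
(`hGZK`). Chain: the newform, Sprung's pair (Sprung 2017 Thm. 1.12); THEOREM B (`PrintX8VSOneColourMuAnX8.
ClassX8.oneColourMuAn`, input-free) picks `•₀` with `L^{•₀} ≠ 0` of unit content; the cyclotomic/Honda frame; a
PRINT-keyed dual `D` of `Sel^{•₀}` (`nonempty_sharpFlatSelmerDualData_rat` at key `γ⁻¹`), f.g. torsion by Thm. 7.14
through the `ι`-dictionary, `char D.X = (ξ)`; §2 ⟹ `ξ ∣ L^{•₀}` integrally; the Euler characteristic (K•) AT KEY `γ` for
`ι ξ` on the real tree-keyed dual (`charIdeal_eq_span_invol_of_inv`; referee N-287b honoured) moved to `ξ` by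
`(ι ξ)(0) = ξ(0)`; p2 g0's key-free `missingUpperBoundAt_of_chromaticUpperDivisibility` (unit-normalised interpolation,
`3 ∤ c_•` on X8). PER PAIR; conditional on the named facts; closes nothing.
[cite: Sprung2012, Thm. 2.2 (p. 1487), Prop. 6.14, Def. 7.11, Thm. 7.14 with (3), Thm. 7.16 (p. 1504), §7.5]
[cite: Sprung2024, §5.2 Lemmas 5.5–5.9 and Proof of Thm. 5.3 (pp. 39–41)] [cite: Sprung2017, Thm. 1.12 and Cor. 4.11]
[cite: Kato2004Asterisque, Thm. 12.5 and Thm. 12.6 (p. 222)] [cite: GreenbergLNM1716, §1 (p. 60)]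
[cite: MazurTateTeitelbaum1986Invent, Ch. I §17] [cite: Pollack2003, Def. 6.15] [cite: Miller2011LMS, Def. 1.1] -/
theorem X8.missingUpperBoundAt_of_sharpFlatKatoContra_of_analyticRank_eq_zero
    (hmodf : exists_isNewformOf) (h22 : thm22_exists_isHondaSystem)
    (h714 : thm714_sharpFlatSelmerDual_finite_torsion)
    (h716c : thm716_sharpFlatCharIdeal_divisibility_contra)
    (hCKc : thm714seq_sharpFlatColemanKato_zeta_contra)
    (h59 : lem59AllN_sharpFlatCharValue_rankZero)
    (h3 : realPeriodRat_eq_unit_mul_plusPeriod_three)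
    (hGZK : rank_eq_analyticRank_of_analyticRank_le_one) (hmod : hasEntireLFunction_rat)
    (hX : ClassX8 W p) (h0 : W.analyticRank = 0) : MissingUpperBoundAt W p := by
  have hp3 : p = 3 := hX.1
  subst hp3
  have hp2 : (3 : ℕ) ≠ 2 := by decide
  have hgood : W.HasGoodReductionAtPrime 3 := hX.2.1.1
  have hdvd : ((3 : ℕ) : ℤ) ∣ W.frobeniusTrace 3 := hX.2.1.2
  have hirr : W.HasIrreducibleModPGaloisRep 3 := ClassX8.irr W 3 hX
  have hL : W.entireLFunction 1 ≠ 0 := (W.analyticRank_eq_zero_iff_holds (hmod W)).1 h0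
  -- the newform (modularity) and Sprung's pair (Sprung 2017 Thm. 1.12)
  haveI : NeZero (W.conductorNorm ℤ) := ⟨(W.conductorNorm_pos_holds).ne'⟩
  obtain ⟨f, hf⟩ := hmodf W
  obtain ⟨Lsharp, Lflat, hSP⟩ :=
    thm112_exists_isSprungPair_holds (W := W) (f := f) (p := 3) hp2 hf hgood hdvd
  -- THEOREM B (input-free): a colour `•₀` with `L^{•₀} ≠ 0` of unit content
  obtain ⟨col, hcol, -, hu, -⟩ :=
    PrintX8VSOneColourMuAnX8.ClassX8.oneColourMuAn W 3 hX _ inferInstance f Lsharp Lflat hf hSP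
  -- the cyclotomic setting, the place above `3`, the local lift, a Honda system (Thm. 2.2)
  obtain ⟨κ, hκ, γ, hγ, hγ'⟩ := exists_isCyclotomic_isTopGenerator_isCyclotomicVariable_holds 3
  obtain ⟨v, hv⟩ :=
    Literature.NumberTheory.NumberFields.RingOfIntegers.exists_heightOneSpectrum_natCast_mem ℚ
      (p := 3) (by norm_num)
  obtain ⟨g, hg⟩ := hκ.exists_isTopGenerator_resGalOfEmb_adicCompletion v hv
  obtain ⟨cneg, c, hc⟩ := h22 W 3 hp2 hgood hdvd κ γ hκ hγ hγ' v hv g hg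
  -- the real tree-keyed dual `D₀` (key `γ`, Thm. 7.14 there) and a PRINT-keyed dual `D` (key `γ⁻¹`) of `Sel^{•₀}`
  let D₀ := sharpFlatSelmerDualData W κ (closureEmb (K := ℚ) (v.adicCompletion ℚ))
    (W.frobeniusTrace 3) g c col hγ
  obtain ⟨hfin₀, htor₀⟩ :=
    h714 W 3 hp2 hgood hdvd f hf κ γ hκ hγ hγ' v hv g hg cneg c hc col Lsharp Lflat hSP hcol D₀
  haveI := hfin₀
  obtain ⟨D⟩ := nonempty_sharpFlatSelmerDualData_rat W κ γ⁻¹ v g c col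
  haveI : Module.Finite (IwasawaAlgebra 3) D.X := (sharpFlatSelmerDualData_finite_inv_iff D₀ D).1 hfin₀
  obtain ⟨gen, hgen⟩ := (charIdeal_isPrincipal_holds 3 D.X).principal
  have hchar : D.charIdeal = Ideal.span {gen} := hgen
  -- (K•) AT KEY `γ` for `ι gen` (Sprung 2024 Lemmas 5.5–5.9, all levels), moved to `gen` by `(ι gen)(0) = gen(0)`
  have hchar₀ : D₀.charIdeal = Ideal.span {invol 3 gen} :=
    X8MainConjectureRoadContra.charIdeal_eq_span_invol_of_inv D₀ D hchar
  have hK₀ : (⟨invol 3 gen, 0, 0⟩ : SignedDatum W 3).EulerCharacteristic := fun hfin =>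
    h59 W 3 hp2 hgood hdvd hL κ γ hκ hγ hγ' v hv g hg cneg c hc col D₀ htor₀ (invol 3 gen) hchar₀ hfin
  have hK : (⟨gen, 0, 0⟩ : SignedDatum W 3).EulerCharacteristic := by
    intro hfin
    obtain ⟨w, hw⟩ := hK₀ hfin
    refine ⟨w, ?_⟩
    change ((PowerSeries.constantCoeff (invol 3 gen) : ℤ_[3]) : ℚ_[3]) = _ at hw
    change ((PowerSeries.constantCoeff gen : ℤ_[3]) : ℚ_[3]) = _
    rw [IwasawaAlgebra.constantCoeff_invol] at hw
    exact hw
  -- §2: Kato through the ♯/♭ Coleman maps, PRINT keying, INTEGRAL on all of X8 for the unit-content colour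
  have hKato : gen ∣ chromaticL col Lsharp Lflat :=
    X8.sharpFlatUpper_dvd_contra_of_hasUnitContent W 3 h714 h716c hCKc h3 hX hκ hγ hγ' hv hg hc hf hSP col hu
      D hchar
  exact missingUpperBoundAt_of_chromaticUpperDivisibility W 3 hGZK hp2 hgood hirr hL hf
    (h3 W hgood hirr f hf) hSP col (ClassX8.not_dvd_chromaticConst' W 3 hX col) gen hK hKato

/-- **UNIT CELLS, X8 ∧ `r_an = 0`, ANY image, PRINT keying: `ord₃ #Ш_an ≤ 0 ⟹ BSD(E,3)`** — the LOWER half is vacuous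
when `3 ∤ #Ш_an`, the upper half is the previous theorem. On the census of open cells: 54 of the 142 rank-`0` X8 cells
(all with image `C_ns⁺(3)`; each of the 82 surj rank-`0` census cells has `3 ∣ #Ш_an`). NO K1, NO K′/C′, NO rider, NO
image datum. PER PAIR; conditional on the named facts; closes nothing.
[cite: Sprung2012, Thm. 7.14 and Thm. 7.16 (p. 1504)] [cite: Sprung2024, §5.2 Lemmas 5.5–5.9]
[cite: Miller2011LMS, §1 and Def. 1.1] -/
theorem X8.bsdp_of_shaAn_le_of_sharpFlatKatoContra_of_analyticRank_eq_zero
    (hmodf : exists_isNewformOf) (h22 : thm22_exists_isHondaSystem)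
    (h714 : thm714_sharpFlatSelmerDual_finite_torsion)
    (h716c : thm716_sharpFlatCharIdeal_divisibility_contra)
    (hCKc : thm714seq_sharpFlatColemanKato_zeta_contra)
    (h59 : lem59AllN_sharpFlatCharValue_rankZero)
    (h3 : realPeriodRat_eq_unit_mul_plusPeriod_three)
    (hGZK : rank_eq_analyticRank_of_analyticRank_le_one) (hmod : hasEntireLFunction_rat)
    (hX : ClassX8 W p) (h0 : W.analyticRank = 0)
    (hsha : ∃ q : ℚ, shaAn W = (q : ℂ) ∧ padicValRat p q ≤ 0) : BSDp W p := by
  refine bsdp_of_missingPPartAt W p hGZK (by omega) (missingPPartAt_of_lower_of_upper W p ?_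
    (X8.missingUpperBoundAt_of_sharpFlatKatoContra_of_analyticRank_eq_zero W p hmodf h22 h714 h716c hCKc h59 h3
      hGZK hmod hX h0))
  obtain ⟨q, hq, hle⟩ := hsha
  exact ⟨q, hq, hle.trans (by exact_mod_cast Nat.zero_le _)⟩

/-- **X8 ∧ `r_an = 0`, ANY image, PRINT keying, LOWER half displayed ⟹ `BSD(E,3)`** — on every rank-`0` X8 pair the
residual beyond the published named facts is EXACTLY `MissingLowerBoundAt W 3` (K1 / K′ ∧ C′ at the pair, or a `3`- /
`9`-descent certificate with Cassels–Tate; 88 of the 142 rank-`0` census cells have `3 ∣ #Ш_an`: 82 surj + 6 `C_ns⁺(3)`).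
PER PAIR; conditional; closes nothing.
[cite: Sprung2012, Thm. 7.16 (p. 1504)] [cite: Sprung2024, §5.2 Lemmas 5.5–5.9] [cite: Miller2011LMS, §1 and Def. 1.1] -/
theorem X8.bsdp_of_missingLowerBoundAt_of_sharpFlatKatoContra_of_analyticRank_eq_zero
    (hmodf : exists_isNewformOf) (h22 : thm22_exists_isHondaSystem)
    (h714 : thm714_sharpFlatSelmerDual_finite_torsion)
    (h716c : thm716_sharpFlatCharIdeal_divisibility_contra)
    (hCKc : thm714seq_sharpFlatColemanKato_zeta_contra)
    (h59 : lem59AllN_sharpFlatCharValue_rankZero)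
    (h3 : realPeriodRat_eq_unit_mul_plusPeriod_three)
    (hGZK : rank_eq_analyticRank_of_analyticRank_le_one) (hmod : hasEntireLFunction_rat)
    (hX : ClassX8 W p) (h0 : W.analyticRank = 0) (hlow : MissingLowerBoundAt W p) : BSDp W p :=
  bsdp_of_missingPPartAt W p hGZK (by omega) (missingPPartAt_of_lower_of_upper W p hlow
    (X8.missingUpperBoundAt_of_sharpFlatKatoContra_of_analyticRank_eq_zero W p hmodf h22 h714 h716c hCKc h59 h3
      hGZK hmod hX h0))

end RankZero

/-! ### §4 CLASS forms on X8 ∩ {r_an = 0} (142 census cells, ANY image), print keying -/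

/-- **CLASS form: the upper half on ALL of X8 ∩ {r_an = 0}, ANY `3`-adic image, PRINT keying** — seat p2's clause 1
«♯♭ ⊇-half from Kato via Sprung's ♯♭ Coleman maps + ♯♭ control ⇒ r0 upper bound» as a kernel theorem modulo the nine
displayed named facts (two of them tree theorems) and THEOREM B; supersedes, for the route's print currency, the
`γ`-keyed `X8.upperHalf_rankZero_surj_of_sharpFlatFacts` (surj only) and p3's rider forms (small image).
[cite: Sprung2012, Thm. 2.2, Thm. 7.14 and Thm. 7.16 (p. 1504)] [cite: Sprung2024, §5.2 Lemmas 5.5–5.9]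
[cite: Kato2004Asterisque, Thm. 12.5 and Thm. 12.6] [cite: Pollack2003, Def. 6.15] -/
theorem X8.upperHalf_rankZero_of_sharpFlatFactsContra
    (hmodf : exists_isNewformOf) (h22 : thm22_exists_isHondaSystem)
    (h714 : thm714_sharpFlatSelmerDual_finite_torsion)
    (h716c : thm716_sharpFlatCharIdeal_divisibility_contra)
    (hCKc : thm714seq_sharpFlatColemanKato_zeta_contra)
    (h59 : lem59AllN_sharpFlatCharValue_rankZero)
    (h3 : realPeriodRat_eq_unit_mul_plusPeriod_three)
    (hGZK : rank_eq_analyticRank_of_analyticRank_le_one) (hmod : hasEntireLFunction_rat) :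
    ∀ (W : WeierstrassCurve ℚ) [W.IsElliptic] [W.IsGloballyMinimal] (p : ℕ) [Fact p.Prime],
      ClassX8 W p → W.analyticRank = 0 → MissingUpperBoundAt W p :=
  fun W _ _ p _ hX h0 ↦
    X8.missingUpperBoundAt_of_sharpFlatKatoContra_of_analyticRank_eq_zero W p hmodf h22 h714 h716c hCKc h59 h3 hGZK
      hmod hX h0

/-- **CLASS form, unit cells: on ALL of X8 ∩ {r_an = 0} ∩ {ord₃ #Ш_an ≤ 0}, ANY image, `BSD(E,3)`** modulo the nine
displayed named facts (54 of the 142 rank-`0` census cells, all `C_ns⁺(3)`) — seat p2's clause 2 «unit cells close outright», print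
keying, image-free. [cite: Sprung2012, Thm. 7.14 and Thm. 7.16 (p. 1504)] [cite: Sprung2024, §5.2 Lemmas 5.5–5.9]
[cite: Miller2011LMS, §1 and Def. 1.1] -/
theorem X8.bsdp_rankZero_shaUnit_of_sharpFlatFactsContra
    (hmodf : exists_isNewformOf) (h22 : thm22_exists_isHondaSystem)
    (h714 : thm714_sharpFlatSelmerDual_finite_torsion)
    (h716c : thm716_sharpFlatCharIdeal_divisibility_contra)
    (hCKc : thm714seq_sharpFlatColemanKato_zeta_contra)
    (h59 : lem59AllN_sharpFlatCharValue_rankZero)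
    (h3 : realPeriodRat_eq_unit_mul_plusPeriod_three)
    (hGZK : rank_eq_analyticRank_of_analyticRank_le_one) (hmod : hasEntireLFunction_rat) :
    ∀ (W : WeierstrassCurve ℚ) [W.IsElliptic] [W.IsGloballyMinimal] (p : ℕ) [Fact p.Prime],
      ClassX8 W p → W.analyticRank = 0 → (∃ q : ℚ, shaAn W = (q : ℂ) ∧ padicValRat p q ≤ 0) → BSDp W p :=
  fun W _ _ p _ hX h0 hsha ↦
    X8.bsdp_of_shaAn_le_of_sharpFlatKatoContra_of_analyticRank_eq_zero W p hmodf h22 h714 h716c hCKc h59 h3 hGZK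
      hmod hX h0 hsha

end Summit.BirchSwinnertonDyer.BirchSwinnertonDyer.Theorems.X8KatoUpperHalfContra

end
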